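import Summits.BirchSwinnertonDyer.BirchSwinnertonDyer.Theorems.ResidualThetaTransportAtTwoLambdaLowerBoundOEulerFactorQuadratic
import HarnessLib

/-!
# The UNIT PART of Frobenius in the Greenberg–Vatsal local term: `λ` of `Λ_𝒪/((Y² − aY + ℓ))` and
# `Λ_𝒪/((ℓ − aY))` for `Y = B^{p^k}` with ANY `B ≡ 1 + ūT + O(T²) (mod 𝔪)`, `ū ≠ 0` — e.g. `B = (1+T)^{u'}`,
# `u' ∈ ℤ_p^×`, so `Y = (1+T)^{u'·p^k}` is the EXACT image of `Frob_ℓ = γ^{u'·p^k}`, no re-parametrisation of `Λ_𝒪`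

Route `ResidualThetaTransportAtTwo` (RTT), crux (R≥)ᵖ `ResidualThetaCountLowerPureAtTwo`
(stmt-BirchSwinnertonDyer-26074), line «bt26-lambda», research stub S2 `stub_cmLambdaLower`, step (f5)/(v)
(imprimitivity) and (e) (local terms) of `Cruxes/ResidualThetaCountLowerPureAtTwo/PROMOTE-S2.md`; width seat
`prover-bsd-rtt-w1` g0 (helper (H2c); `--supports`, closes nothing). Sequel of
`…LambdaLowerBoundOEulerFactorQuadratic` (p644201: the case `B = 1 + T`).
HONEST FRAMING: THEOREMS ONLY (no definition, no named fact, no instance, no `sorry`); pure commutative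
algebra; nothing about any Selmer group, Galois cohomology group or modular form is asserted; BSD is not
proved by any of this.

WHY. In `Λ_𝒪 = 𝒪⟦T⟧` (`γ ↦ 1+T`) the Frobenius at an odd prime `ℓ` of the cyclotomic `ℤ₂`-extension is
`γ^{u_ℓ}` with `v₂(u_ℓ) = k = v₂((ℓ²−1)/8)`, i.e. `u_ℓ = u'·2^k` with `u'` a UNIT, so its image is
`Y = (1+T)^{u_ℓ} = ((1+T)^{u'})^{2^k}` — not `(1+T)^{2^k}`. PROMOTE-S2 §2(e) and the companion files
(p627158, p644201, p644557) treat `u' = 1` and defer the unit to «an automorphism of `Λ_𝒪`» (the substitution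
`T ↦ (1+T)^{u'} − 1`), which the tree does not have. This file removes the caveat WITHOUT that automorphism:
every computation of the companion file goes through verbatim for `Y = B^{p^k}` as soon as
`B ≡ 1 + ūT + (higher) (mod 𝔪)` with `ū ≠ 0`, because modulo `𝔪` one has `B^{p^k} = 1 + (B̄ − 1)^{p^k}`
(freshman's dream) and `(B̄ − 1)^{p^k}` has `T`-order EXACTLY `p^k` over the residue FIELD (`order_pow`).
For `B = (1+T)^{u'} = ∑ binom(u',n) Tⁿ` (`PowerSeries.binomialSeries`): `B(0) = 1`, `B₁ = u'`, a unit.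

* §1 (`K` a field) orders of `C c₀ + C c₁·h + h²` and `C c₀ + C c₁·h` for `h` with `h(0) = 0`, `ord h = n`:
  `0` / `n` / `2n` and `0` / `n` (`order_mul`).
* §2 (local `O`, residue characteristic `p`) for `B` with `B(0) ≡ 1`, `B₁ ≢ 0 (mod 𝔪)`:
  `map_residue_pow_prime_pow` (`B^{p^k} ↦ 1 + (B̄−1)^{p^k}`), `order_map_residue_sub_one(_pow)` (orders `1`,
  `p^k`), `map_residue_eulerQuadratic_pow` / `map_residue_eulerLinear_pow` (normal forms) and the five order
  computations `order_map_eulerQuadratic_pow_of_*` (`0` / `p^k` / `2p^k`), `order_map_eulerLinear_pow_of_*`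
  (`0` / `p^k`) — by `P̄(1)`, `P̄'(1)` exactly as for `B = 1 + T`.
* §3 (over `𝒪 = 𝒪_E`, `E/ℚ_p` finite): **`free_finrank_quotient_span_eulerQuadratic_pow_of_*`** (three cases),
  **`free_finrank_quotient_span_eulerLinear_pow_of_*`** (two cases): `Λ_𝒪/((Y² − aY + ℓ))`, `Λ_𝒪/((ℓ − aY))`,
  `Y = B^{p^k}`, are FREE over `𝒪` of rank `p^k ·` (multiplicity of `1` as a root of `Ȳ² − āȲ + ℓ̄`), resp.
  `p^k · [ℓ̄ = ā]` (Weierstrass preparation, `free_finrank_quotient_span_of_order_eq`, p625410).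
The case `p = 2`, `ℓ` odd, in the crux's norm currency / on the crux's carriers, and `B = binomialSeries u'`,
is the sequel `…EulerFactorUnitPowerAtTwo`.

References: [GreenbergVatsal2000] §2, Prop. 2.4 (`λ(𝓟_ℓ) = s_ℓ d_ℓ`; `𝓟_η = P_ℓ(ℓ⁻¹γ_η)`, `γ_η` the
Frobenius in `Γ`, a topological generator of the decomposition group `Γ^{p^k}`) and Cor. 2.3;
[Washington1997] §7.1 Thm. 7.3 (Weierstrass preparation), §13 (`γ^a ↦ (1+T)^a`).
-/

set_option autoImplicit false
-- the Theorems namespace of this sub repeats the summit name by design (D-0017 nested layout)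
set_option linter.dupNamespace false

noncomputable section

open scoped Classical
open PowerSeries

namespace Summit.BirchSwinnertonDyer.BirchSwinnertonDyer.Theorems.LambdaLowerBoundO

universe u

/-! ### §1. Orders of `C c₀ + C c₁·h + h²` and `C c₀ + C c₁·h` over a field -/

section Orders

variable {K : Type u} [Field K]

/-- `ord_T(φ) = 0` when `φ(0) ≠ 0`. [folklore] -/
theorem order_eq_natCast_zero_of_constantCoeff_ne_zero {φ : PowerSeries K} (h : constantCoeff φ ≠ 0) :
    φ.order = ((0 : ℕ) : ℕ∞) := by
  rw [order_eq_nat]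
  refine ⟨?_, fun i hi => absurd hi (Nat.not_lt_zero i)⟩
  rwa [coeff_zero_eq_constantCoeff_apply]

/-- `ord_T(C c₀ + C c₁·h + h²) = 0` when `h(0) = 0` and `c₀ ≠ 0`. [folklore] -/
theorem order_C_add_C_mul_add_sq_of_ne_zero {h : PowerSeries K} (hh : constantCoeff h = 0) {c₀ c₁ : K}
    (h₀ : c₀ ≠ 0) : (C c₀ + C c₁ * h + h ^ 2).order = ((0 : ℕ) : ℕ∞) := by
  apply order_eq_natCast_zero_of_constantCoeff_ne_zero
  rw [map_add, map_add, map_mul, map_pow, constantCoeff_C, constantCoeff_C, hh, mul_zero, add_zero,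
    zero_pow two_ne_zero, add_zero]
  exact h₀

/-- `ord_T(C 0 + C c₁·h + h²) = ord_T(h)` when `c₁ ≠ 0` (and `h(0) = 0`). [folklore] -/
theorem order_C_add_C_mul_add_sq_of_eq_zero_of_ne_zero {h : PowerSeries K} {n : ℕ} (hn : h.order = (n : ℕ∞))
    (hh : constantCoeff h = 0) {c₀ c₁ : K} (h₀ : c₀ = 0) (h₁ : c₁ ≠ 0) :
    (C c₀ + C c₁ * h + h ^ 2).order = (n : ℕ∞) := by
  subst h₀
  have hfac : C (0 : K) + C c₁ * h + h ^ 2 = h * (C c₁ + h) := by rw [map_zero, zero_add]; ring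
  have h0 : (C c₁ + h).order = ((0 : ℕ) : ℕ∞) := by
    apply order_eq_natCast_zero_of_constantCoeff_ne_zero
    rw [map_add, constantCoeff_C, hh, add_zero]
    exact h₁
  rw [hfac, order_mul, hn, h0, Nat.cast_zero, add_zero]

/-- `ord_T(C 0 + C 0·h + h²) = 2·ord_T(h)`. [folklore] -/
theorem order_C_add_C_mul_add_sq_of_eq_zero_of_eq_zero {h : PowerSeries K} {n : ℕ} (hn : h.order = (n : ℕ∞))
    {c₀ c₁ : K} (h₀ : c₀ = 0) (h₁ : c₁ = 0) :
    (C c₀ + C c₁ * h + h ^ 2).order = ((2 * n : ℕ) : ℕ∞) := by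
  subst h₀ h₁
  rw [map_zero, zero_mul, zero_add, zero_add, pow_two, order_mul, hn, ← Nat.cast_add, ← two_mul]

/-- `ord_T(C c₀ + C c₁·h) = 0` when `h(0) = 0` and `c₀ ≠ 0`. [folklore] -/
theorem order_C_add_C_mul_of_constantCoeff_eq_zero_of_ne_zero {h : PowerSeries K} (hh : constantCoeff h = 0)
    {c₀ c₁ : K} (h₀ : c₀ ≠ 0) : (C c₀ + C c₁ * h).order = ((0 : ℕ) : ℕ∞) := by
  apply order_eq_natCast_zero_of_constantCoeff_ne_zero
  rw [map_add, map_mul, constantCoeff_C, constantCoeff_C, hh, mul_zero, add_zero]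
  exact h₀

/-- `ord_T(C 0 + C c₁·h) = ord_T(h)` when `c₁ ≠ 0`. [folklore] -/
theorem order_C_add_C_mul_of_order_eq_of_ne_zero {h : PowerSeries K} {n : ℕ} (hn : h.order = (n : ℕ∞))
    {c₀ c₁ : K} (h₀ : c₀ = 0) (h₁ : c₁ ≠ 0) : (C c₀ + C c₁ * h).order = (n : ℕ∞) := by
  subst h₀
  have hC : (C c₁ : PowerSeries K).order = ((0 : ℕ) : ℕ∞) :=
    order_eq_natCast_zero_of_constantCoeff_ne_zero (by rw [constantCoeff_C]; exact h₁)
  rw [map_zero, zero_add, order_mul, hC, hn, Nat.cast_zero, zero_add]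

end Orders

/-! ### §2. `Y = B^{p^k}` modulo `𝔪` for `B ≡ 1 + ūT + O(T²)`, `ū ≠ 0` -/

section Residual

variable {O : Type u} [CommRing O] [IsLocalRing O] (p : ℕ) [Fact p.Prime]
  [CharP (IsLocalRing.ResidueField O) p]

/-- **Freshman's dream for `Y = B^{p^k}`**: `B^{p^k} ↦ 1 + (B̄ − 1)^{p^k}` modulo `𝔪`. [folklore] -/
theorem map_residue_pow_prime_pow (k : ℕ) (B : PowerSeries O) :
    (B ^ (p ^ k)).map (IsLocalRing.residue O) =
      1 + (B.map (IsLocalRing.residue O) - 1) ^ (p ^ k) := by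
  haveI : CharP (PowerSeries (IsLocalRing.ResidueField O)) p :=
    charP_of_injective_algebraMap (algebraMap (IsLocalRing.ResidueField O) _).injective p
  obtain ⟨g, hg⟩ : ∃ g : PowerSeries (IsLocalRing.ResidueField O), B.map (IsLocalRing.residue O) = 1 + g :=
    ⟨B.map (IsLocalRing.residue O) - 1, by ring⟩
  rw [map_pow, hg, add_sub_cancel_left, add_pow_char_pow, one_pow]

omit [CharP (IsLocalRing.ResidueField O) p] in
/-- `(B̄ − 1)(0) = 0` when `B(0) ≡ 1 (mod 𝔪)`, hence `((B̄ − 1)^{p^k})(0) = 0`. [folklore] -/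
theorem constantCoeff_map_residue_sub_one_pow (k : ℕ) {B : PowerSeries O}
    (hB0 : IsLocalRing.residue O (constantCoeff B) = 1) :
    constantCoeff ((B.map (IsLocalRing.residue O) - 1) ^ (p ^ k)) = 0 := by
  rw [map_pow, map_sub, map_one, ← coeff_zero_eq_constantCoeff_apply, coeff_map,
    coeff_zero_eq_constantCoeff_apply, hB0, sub_self, zero_pow (pow_ne_zero _ (Fact.out : p.Prime).ne_zero)]

omit [CharP (IsLocalRing.ResidueField O) p] in
/-- **`ord_T(B̄ − 1) = 1`** when `B(0) ≡ 1` and `B₁ ≢ 0 (mod 𝔪)`. [folklore] -/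
theorem order_map_residue_sub_one {B : PowerSeries O} (hB0 : IsLocalRing.residue O (constantCoeff B) = 1)
    (hB1 : IsLocalRing.residue O (coeff 1 B) ≠ 0) :
    (B.map (IsLocalRing.residue O) - 1).order = ((1 : ℕ) : ℕ∞) := by
  rw [order_eq_nat]
  refine ⟨?_, fun i hi => ?_⟩
  · rw [map_sub, coeff_map, coeff_one, if_neg one_ne_zero, sub_zero]
    exact hB1
  · obtain rfl : i = 0 := Nat.lt_one_iff.mp hi
    rw [map_sub, coeff_map, coeff_zero_eq_constantCoeff_apply, hB0, coeff_zero_eq_constantCoeff_apply, map_one,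
      sub_self]

omit [Fact p.Prime] [CharP (IsLocalRing.ResidueField O) p] in
/-- **`ord_T((B̄ − 1)^{p^k}) = p^k`** when `B(0) ≡ 1` and `B₁ ≢ 0 (mod 𝔪)` (the residue field is a field:
`order_pow`). [folklore] -/
theorem order_map_residue_sub_one_pow (k : ℕ) {B : PowerSeries O}
    (hB0 : IsLocalRing.residue O (constantCoeff B) = 1) (hB1 : IsLocalRing.residue O (coeff 1 B) ≠ 0) :
    ((B.map (IsLocalRing.residue O) - 1) ^ (p ^ k)).order = ((p ^ k : ℕ) : ℕ∞) := by
  rw [order_pow, order_map_residue_sub_one hB0 hB1, Nat.cast_one, nsmul_eq_mul, mul_one]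

/-- **The quadratic Euler-factor series at `Y = B^{p^k}` modulo `𝔪`**: with `h = (B̄ − 1)^{p^k}`,
`Y² − aY + ℓ ↦ C(1 − ā + ℓ̄) + C(2 − ā)·h + h²`. [cite: GreenbergVatsal2000, §2 Prop. 2.4] -/
theorem map_residue_eulerQuadratic_pow (k : ℕ) (B : PowerSeries O) (a l : O) :
    ((B ^ (p ^ k)) ^ 2 - C a * B ^ (p ^ k) + C l).map (IsLocalRing.residue O) =
      C (1 - IsLocalRing.residue O a + IsLocalRing.residue O l) +
        C (2 - IsLocalRing.residue O a) * (B.map (IsLocalRing.residue O) - 1) ^ (p ^ k) +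
        ((B.map (IsLocalRing.residue O) - 1) ^ (p ^ k)) ^ 2 := by
  conv_lhs => rw [pow_two, map_add, map_sub, map_mul, map_mul, map_residue_pow_prime_pow p k B, map_C, map_C]
  simp only [map_sub, map_add, map_one, map_ofNat]
  ring

/-- **The linear Euler-factor series at `Y = B^{p^k}` modulo `𝔪`**: with `h = (B̄ − 1)^{p^k}`,
`ℓ − aY ↦ C(ℓ̄ − ā) + C(−ā)·h`. [cite: GreenbergVatsal2000, §2 Prop. 2.4] -/
theorem map_residue_eulerLinear_pow (k : ℕ) (B : PowerSeries O) (a l : O) :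
    (C l - C a * B ^ (p ^ k)).map (IsLocalRing.residue O) =
      C (IsLocalRing.residue O l - IsLocalRing.residue O a) +
        C (-IsLocalRing.residue O a) * (B.map (IsLocalRing.residue O) - 1) ^ (p ^ k) := by
  conv_lhs => rw [map_sub, map_mul, map_residue_pow_prime_pow p k B, map_C, map_C]
  simp only [map_sub, map_neg]
  ring

/-- `ord_T((Y² − aY + ℓ) mod 𝔪) = 0`, `Y = B^{p^k}`, when `P̄(1) = 1 − ā + ℓ̄ ≠ 0`.
[cite: GreenbergVatsal2000, §2 Prop. 2.4] -/
theorem order_map_eulerQuadratic_pow_of_ne_zero (k : ℕ) {B : PowerSeries O}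
    (hB0 : IsLocalRing.residue O (constantCoeff B) = 1) {a l : O}
    (h : 1 - IsLocalRing.residue O a + IsLocalRing.residue O l ≠ 0) :
    (((B ^ (p ^ k)) ^ 2 - C a * B ^ (p ^ k) + C l).map (IsLocalRing.residue O)).order = ((0 : ℕ) : ℕ∞) := by
  rw [map_residue_eulerQuadratic_pow p]
  exact order_C_add_C_mul_add_sq_of_ne_zero (constantCoeff_map_residue_sub_one_pow p k hB0) h

/-- `ord_T((Y² − aY + ℓ) mod 𝔪) = p^k`, `Y = B^{p^k}`, when `P̄(1) = 0 ≠ P̄'(1) = 2 − ā`.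
[cite: GreenbergVatsal2000, §2 Prop. 2.4] -/
theorem order_map_eulerQuadratic_pow_of_eq_zero_of_ne_zero (k : ℕ) {B : PowerSeries O}
    (hB0 : IsLocalRing.residue O (constantCoeff B) = 1) (hB1 : IsLocalRing.residue O (coeff 1 B) ≠ 0)
    {a l : O} (h : 1 - IsLocalRing.residue O a + IsLocalRing.residue O l = 0)
    (h' : 2 - IsLocalRing.residue O a ≠ 0) :
    (((B ^ (p ^ k)) ^ 2 - C a * B ^ (p ^ k) + C l).map (IsLocalRing.residue O)).order =
      ((p ^ k : ℕ) : ℕ∞) := by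
  rw [map_residue_eulerQuadratic_pow p]
  exact order_C_add_C_mul_add_sq_of_eq_zero_of_ne_zero (order_map_residue_sub_one_pow p k hB0 hB1)
    (constantCoeff_map_residue_sub_one_pow p k hB0) h h'

/-- `ord_T((Y² − aY + ℓ) mod 𝔪) = 2p^k`, `Y = B^{p^k}`, when `P̄(1) = 0 = P̄'(1)`.
[cite: GreenbergVatsal2000, §2 Prop. 2.4] -/
theorem order_map_eulerQuadratic_pow_of_eq_zero_of_eq_zero (k : ℕ) {B : PowerSeries O}
    (hB0 : IsLocalRing.residue O (constantCoeff B) = 1) (hB1 : IsLocalRing.residue O (coeff 1 B) ≠ 0)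
    {a l : O} (h : 1 - IsLocalRing.residue O a + IsLocalRing.residue O l = 0)
    (h' : 2 - IsLocalRing.residue O a = 0) :
    (((B ^ (p ^ k)) ^ 2 - C a * B ^ (p ^ k) + C l).map (IsLocalRing.residue O)).order =
      ((2 * p ^ k : ℕ) : ℕ∞) := by
  rw [map_residue_eulerQuadratic_pow p]
  exact order_C_add_C_mul_add_sq_of_eq_zero_of_eq_zero (order_map_residue_sub_one_pow p k hB0 hB1) h h'

/-- `ord_T((ℓ − aY) mod 𝔪) = 0`, `Y = B^{p^k}`, when `ℓ̄ ≠ ā`. [cite: GreenbergVatsal2000, §2 Prop. 2.4] -/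
theorem order_map_eulerLinear_pow_of_ne (k : ℕ) {B : PowerSeries O}
    (hB0 : IsLocalRing.residue O (constantCoeff B) = 1) {a l : O}
    (h : IsLocalRing.residue O l ≠ IsLocalRing.residue O a) :
    ((C l - C a * B ^ (p ^ k)).map (IsLocalRing.residue O)).order = ((0 : ℕ) : ℕ∞) := by
  rw [map_residue_eulerLinear_pow p]
  exact order_C_add_C_mul_of_constantCoeff_eq_zero_of_ne_zero (constantCoeff_map_residue_sub_one_pow p k hB0)
    (sub_ne_zero.2 h)

/-- `ord_T((ℓ − aY) mod 𝔪) = p^k`, `Y = B^{p^k}`, when `ℓ̄ = ā ≠ 0`. [cite: GreenbergVatsal2000, §2 Prop. 2.4] -/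
theorem order_map_eulerLinear_pow_of_eq (k : ℕ) {B : PowerSeries O}
    (hB0 : IsLocalRing.residue O (constantCoeff B) = 1) (hB1 : IsLocalRing.residue O (coeff 1 B) ≠ 0)
    {a l : O} (h : IsLocalRing.residue O l = IsLocalRing.residue O a) (h0 : IsLocalRing.residue O a ≠ 0) :
    ((C l - C a * B ^ (p ^ k)).map (IsLocalRing.residue O)).order = ((p ^ k : ℕ) : ℕ∞) := by
  rw [map_residue_eulerLinear_pow p]
  exact order_C_add_C_mul_of_order_eq_of_ne_zero (order_map_residue_sub_one_pow p k hB0 hB1) (sub_eq_zero.2 h)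
    (neg_ne_zero.2 h0)

end Residual

/-! ### §3. Over `𝒪 = 𝒪_E`: `Λ_𝒪/((Y² − aY + ℓ))`, `Λ_𝒪/((ℓ − aY))`, `Y = B^{p^k}`, are free of the expected rank -/

section UnitBall

open Literature.NumberTheory.Automorphic

variable (p : ℕ) [Fact p.Prime] (E : IntermediateField ℚ_[p] (PadicAlgCl p)) [FiniteDimensional ℚ_[p] E]

/-- **`λ(Λ_𝒪/((Y² − aY + ℓ))) = 0`, `Y = B^{p^k}`, when `1` is not a root of `Ȳ² − āȲ + ℓ̄`** (free of rank `0`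
over `𝒪 = 𝒪_E`; `B(0) ≡ 1 (mod 𝔪)`). [cite: GreenbergVatsal2000, §2 Prop. 2.4] [cite: Washington1997, §7.1 Thm. 7.3] -/
theorem free_finrank_quotient_span_eulerQuadratic_pow_of_ne_zero (k : ℕ)
    {B : PowerSeries (PadicIntermediateField.unitBall p E)}
    (hB0 : IsLocalRing.residue (PadicIntermediateField.unitBall p E) (constantCoeff B) = 1)
    {a l : PadicIntermediateField.unitBall p E}
    (h : 1 - IsLocalRing.residue (PadicIntermediateField.unitBall p E) a +
      IsLocalRing.residue (PadicIntermediateField.unitBall p E) l ≠ 0) :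
    Module.Free (PadicIntermediateField.unitBall p E)
        (PowerSeries (PadicIntermediateField.unitBall p E) ⧸
          Ideal.span {(B ^ (p ^ k)) ^ 2 - C a * B ^ (p ^ k) + C l}) ∧
      Module.Finite (PadicIntermediateField.unitBall p E)
        (PowerSeries (PadicIntermediateField.unitBall p E) ⧸
          Ideal.span {(B ^ (p ^ k)) ^ 2 - C a * B ^ (p ^ k) + C l}) ∧
      Module.finrank (PadicIntermediateField.unitBall p E)
        (PowerSeries (PadicIntermediateField.unitBall p E) ⧸
          Ideal.span {(B ^ (p ^ k)) ^ 2 - C a * B ^ (p ^ k) + C l}) = 0 := by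
  haveI := charP_residueField_unitBall p E
  exact free_finrank_quotient_span_of_order_eq p E _ 0 (order_map_eulerQuadratic_pow_of_ne_zero p k hB0 h)

/-- **`λ(Λ_𝒪/((Y² − aY + ℓ))) = p^k`, `Y = B^{p^k}`, when `1` is a simple root of `Ȳ² − āȲ + ℓ̄`** (free of
rank `p^k` over `𝒪 = 𝒪_E`; `B ≡ 1 + ūT + O(T²)`, `ū ≠ 0`). [cite: GreenbergVatsal2000, §2 Prop. 2.4]
[cite: Washington1997, §7.1 Thm. 7.3] -/
theorem free_finrank_quotient_span_eulerQuadratic_pow_of_eq_zero_of_ne_zero (k : ℕ)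
    {B : PowerSeries (PadicIntermediateField.unitBall p E)}
    (hB0 : IsLocalRing.residue (PadicIntermediateField.unitBall p E) (constantCoeff B) = 1)
    (hB1 : IsLocalRing.residue (PadicIntermediateField.unitBall p E) (coeff 1 B) ≠ 0)
    {a l : PadicIntermediateField.unitBall p E}
    (h : 1 - IsLocalRing.residue (PadicIntermediateField.unitBall p E) a +
      IsLocalRing.residue (PadicIntermediateField.unitBall p E) l = 0)
    (h' : 2 - IsLocalRing.residue (PadicIntermediateField.unitBall p E) a ≠ 0) :
    Module.Free (PadicIntermediateField.unitBall p E)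
        (PowerSeries (PadicIntermediateField.unitBall p E) ⧸
          Ideal.span {(B ^ (p ^ k)) ^ 2 - C a * B ^ (p ^ k) + C l}) ∧
      Module.Finite (PadicIntermediateField.unitBall p E)
        (PowerSeries (PadicIntermediateField.unitBall p E) ⧸
          Ideal.span {(B ^ (p ^ k)) ^ 2 - C a * B ^ (p ^ k) + C l}) ∧
      Module.finrank (PadicIntermediateField.unitBall p E)
        (PowerSeries (PadicIntermediateField.unitBall p E) ⧸
          Ideal.span {(B ^ (p ^ k)) ^ 2 - C a * B ^ (p ^ k) + C l}) = p ^ k := by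
  haveI := charP_residueField_unitBall p E
  exact free_finrank_quotient_span_of_order_eq p E _ (p ^ k)
    (order_map_eulerQuadratic_pow_of_eq_zero_of_ne_zero p k hB0 hB1 h h')

/-- **`λ(Λ_𝒪/((Y² − aY + ℓ))) = 2p^k`, `Y = B^{p^k}`, when `1` is a double root of `Ȳ² − āȲ + ℓ̄`** (free of
rank `2p^k` over `𝒪 = 𝒪_E`; `B ≡ 1 + ūT + O(T²)`, `ū ≠ 0`). [cite: GreenbergVatsal2000, §2 Prop. 2.4]
[cite: Washington1997, §7.1 Thm. 7.3] -/
theorem free_finrank_quotient_span_eulerQuadratic_pow_of_eq_zero_of_eq_zero (k : ℕ)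
    {B : PowerSeries (PadicIntermediateField.unitBall p E)}
    (hB0 : IsLocalRing.residue (PadicIntermediateField.unitBall p E) (constantCoeff B) = 1)
    (hB1 : IsLocalRing.residue (PadicIntermediateField.unitBall p E) (coeff 1 B) ≠ 0)
    {a l : PadicIntermediateField.unitBall p E}
    (h : 1 - IsLocalRing.residue (PadicIntermediateField.unitBall p E) a +
      IsLocalRing.residue (PadicIntermediateField.unitBall p E) l = 0)
    (h' : 2 - IsLocalRing.residue (PadicIntermediateField.unitBall p E) a = 0) :
    Module.Free (PadicIntermediateField.unitBall p E)
        (PowerSeries (PadicIntermediateField.unitBall p E) ⧸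
          Ideal.span {(B ^ (p ^ k)) ^ 2 - C a * B ^ (p ^ k) + C l}) ∧
      Module.Finite (PadicIntermediateField.unitBall p E)
        (PowerSeries (PadicIntermediateField.unitBall p E) ⧸
          Ideal.span {(B ^ (p ^ k)) ^ 2 - C a * B ^ (p ^ k) + C l}) ∧
      Module.finrank (PadicIntermediateField.unitBall p E)
        (PowerSeries (PadicIntermediateField.unitBall p E) ⧸
          Ideal.span {(B ^ (p ^ k)) ^ 2 - C a * B ^ (p ^ k) + C l}) = 2 * p ^ k := by
  haveI := charP_residueField_unitBall p E
  exact free_finrank_quotient_span_of_order_eq p E _ (2 * p ^ k)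
    (order_map_eulerQuadratic_pow_of_eq_zero_of_eq_zero p k hB0 hB1 h h')

/-- **`λ(Λ_𝒪/((ℓ − aY))) = 0`, `Y = B^{p^k}`, when `ℓ̄ ≠ ā`** (free of rank `0` over `𝒪 = 𝒪_E`; `B(0) ≡ 1`).
[cite: GreenbergVatsal2000, §2 Prop. 2.4] [cite: Washington1997, §7.1 Thm. 7.3] -/
theorem free_finrank_quotient_span_eulerLinear_pow_of_ne (k : ℕ)
    {B : PowerSeries (PadicIntermediateField.unitBall p E)}
    (hB0 : IsLocalRing.residue (PadicIntermediateField.unitBall p E) (constantCoeff B) = 1)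
    {a l : PadicIntermediateField.unitBall p E}
    (h : IsLocalRing.residue (PadicIntermediateField.unitBall p E) l ≠
      IsLocalRing.residue (PadicIntermediateField.unitBall p E) a) :
    Module.Free (PadicIntermediateField.unitBall p E)
        (PowerSeries (PadicIntermediateField.unitBall p E) ⧸ Ideal.span {C l - C a * B ^ (p ^ k)}) ∧
      Module.Finite (PadicIntermediateField.unitBall p E)
        (PowerSeries (PadicIntermediateField.unitBall p E) ⧸ Ideal.span {C l - C a * B ^ (p ^ k)}) ∧
      Module.finrank (PadicIntermediateField.unitBall p E)
        (PowerSeries (PadicIntermediateField.unitBall p E) ⧸ Ideal.span {C l - C a * B ^ (p ^ k)}) = 0 := by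
  haveI := charP_residueField_unitBall p E
  exact free_finrank_quotient_span_of_order_eq p E _ 0 (order_map_eulerLinear_pow_of_ne p k hB0 h)

/-- **`λ(Λ_𝒪/((ℓ − aY))) = p^k`, `Y = B^{p^k}`, when `ℓ̄ = ā ≠ 0`** (free of rank `p^k` over `𝒪 = 𝒪_E`;
`B ≡ 1 + ūT + O(T²)`, `ū ≠ 0`). [cite: GreenbergVatsal2000, §2 Prop. 2.4] [cite: Washington1997, §7.1 Thm. 7.3] -/
theorem free_finrank_quotient_span_eulerLinear_pow_of_eq (k : ℕ)
    {B : PowerSeries (PadicIntermediateField.unitBall p E)}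
    (hB0 : IsLocalRing.residue (PadicIntermediateField.unitBall p E) (constantCoeff B) = 1)
    (hB1 : IsLocalRing.residue (PadicIntermediateField.unitBall p E) (coeff 1 B) ≠ 0)
    {a l : PadicIntermediateField.unitBall p E}
    (h : IsLocalRing.residue (PadicIntermediateField.unitBall p E) l =
      IsLocalRing.residue (PadicIntermediateField.unitBall p E) a)
    (h0 : IsLocalRing.residue (PadicIntermediateField.unitBall p E) a ≠ 0) :
    Module.Free (PadicIntermediateField.unitBall p E)
        (PowerSeries (PadicIntermediateField.unitBall p E) ⧸ Ideal.span {C l - C a * B ^ (p ^ k)}) ∧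
      Module.Finite (PadicIntermediateField.unitBall p E)
        (PowerSeries (PadicIntermediateField.unitBall p E) ⧸ Ideal.span {C l - C a * B ^ (p ^ k)}) ∧
      Module.finrank (PadicIntermediateField.unitBall p E)
        (PowerSeries (PadicIntermediateField.unitBall p E) ⧸ Ideal.span {C l - C a * B ^ (p ^ k)}) = p ^ k := by
  haveI := charP_residueField_unitBall p E
  exact free_finrank_quotient_span_of_order_eq p E _ (p ^ k) (order_map_eulerLinear_pow_of_eq p k hB0 hB1 h h0)

end UnitBall

end Summit.BirchSwinnertonDyer.BirchSwinnertonDyer.Theorems.LambdaLowerBoundO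

end
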